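import Summits.Ventures.CertifiedManyBodySolver.Downfold.EmeryBoxesCCOCK26ThermalCapRetiltMarkovBoxp1
import Summits.Ventures.CertifiedManyBodySolver.Downfold.EmeryBoxesCCOCK26ThermalFloorAtlasWord
import Summits.Ventures.CertifiedManyBodySolver.Downfold.EmeryThermalAtomicFloor
import HarnessLib

/-!
# HIGH-TEMPERATURE-CLOSING `T > 0` WINDOW on Ca1.9Na0.1CuO2Cl2 (M36) [parent Ca2CuO2Cl2 M58 shares the one-body rows, n_holes 1] — U-SL — `emeryBoxCCOCK26` (router/EMERY-FLOOR-ORDERS row 46): the ATOMIC-LIMIT floor (full entropy) ∨ the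
# family floor, against the re-tilted cap — both sides meet at `6 log 2` as β → 0

Venture CertifiedManyBodySolver, cell `pub/hubbard-downfold` (S1 = ROUTER) × crew hubbard-fast S2 (ii) × (iv) «T > 0 × multi-band» (D-0096 (ii)); seat hubbard-downfold-mod-4
(S1/S2 Emery seam, g17). Namespace `Summit.Ventures.CertifiedManyBodySolver.Downfold`. DOOR: `EmeryThermalAtomicFloor` (`holdsOn_emeryCellPressureAtomicFloor`: Peierls on the
whole occupation basis of the `Cu₄O₈` block, site-wise factorisation; the one-site function is the tree's `atomicPartitionFnReal β U μ`). INPUTS BY NAME: the family floor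
`emeryBoxCCOCK26_pressureFloorFam_m10` (`EmeryBoxesCCOCK26ThermalFloorAtlasWord`; C = (-146.878157, -148.577713)), the cap `emeryBoxCCOCK26_pressureCap_m10_retilt` (`EmeryBoxesCCOCK26ThermalCapRetiltMarkovBoxp1`; `6 log 2 + 41.8389·β`; flat word 45.4389).
ATOMIC DATA: Cu at `μ_d = −(εp + Δ_hi) = 331/50`, `U_d,hi = 154/25`; O at `μ_p = −εp = 10`, `U_p,hi = 2619/500` ⇒ classical slope 36.6040·β (family slope 37.1444; cap 41.8389).
RESULT: **`emeryBoxCCOCK26_pressureWindowHighT_m10`**: `max(atomic, family) ≤ P_cell ≤ 6 log 2 + 41.8389·β` on the whole box, every β ≥ 0; width → 0 as β → 0 (both sides `6 log 2`,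
`emeryBoxCCOCK26_pressure_beta_zero_m10`); crossover β* ≈ 1.328 (T* ≈ 8740 K) below which the atomic floor is the better floor [float].

Everything PROVED (0 sorry); no definition. HONEST FRAMING: CERTIFIED inequalities on a SCREENING/EXTRAPOLATED-grade object; the atomic floor ignores hopping (its slope sits
0.5404 below the family floor's), so at physical temperatures (β ≈ 20–40 eV⁻¹) the family floor still decides and thermal scales are NOT resolved there; what is new
is the correct INFINITE-TEMPERATURE closure of the window and a certified high-T regime (β ≲ β*) with width `≈ 5.2348·β`; grand-canonical at the stated level; no phase word;
no router number moves. WHAT-THIS-IS-NOT: a new certificate (pure algebra on landed objects; zero kit).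
-/

noncomputable section

namespace Summit.Ventures.CertifiedManyBodySolver.Downfold

open NonemptyInterval Matrix Finset Literature.Probability.LatticeModels
open Literature.MathematicalPhysics.QuantumLattice Literature.Computation.Certificates
open Summit.Ventures.CertifiedManyBodySolver.Certificates OccupationCode ClusterLowerBound
open scoped BigOperators ComplexOrder

/-! ## §1 The atomic-limit floor on the box at εp = -10 -/

/-- **ATOMIC-LIMIT `T > 0` FLOOR** on the whole `emeryBoxCCOCK26`, cuprate signs, level εp = -10 (chemical potential 10 eV), EVERY β ≥ 0:
`log z₀(β; U_d = 154/25, μ_d = 331/50) + 2·log z₀(β; U_p = 2619/500, μ_p = 10) ≤ P_cell` with `z₀(β; U, μ) = 1 + 2e^{βμ} + e^{−β(U−2μ)}` (`atomicPartitionFnReal`; Cu at the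
box's upper level `εp + Δ_hi = -331/50` and `U_d,hi`, O at `εp` and `U_p,hi`). Value `6 log 2` at β = 0; slope `36.6040·β` as β → ∞ (classical minimum, no hopping).
[cite: Ruelle1969, §2.5–2.6] [cite: Ueltschi1999, §3] -/
theorem emeryBoxCCOCK26_pressureAtomicFloor_m10 {β : ℝ} (hβ : 0 ≤ β) :
    HoldsOn (fun p : EmeryCoord → ℝ => Real.log (atomicPartitionFnReal β (154/25 : ℝ) (331/50 : ℝ)) + 2 * Real.log (atomicPartitionFnReal β (2619/500 : ℝ) (10 : ℝ)) ≤ emeryCellPressure β (emeryLine cuprateSigns (emeryLineCoords (((-10 : ℚ)) : ℝ) p))) emeryBoxCCOCK26 := by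
  intro p hp
  have h := holdsOn_emeryCellPressureAtomicFloor (E := emeryBoxCCOCK26) (eA := ccocK26Emery_tpd) (eB := ccocK26Emery_tpp) (eD := ccocK26Emery_Delta) (eUd := ccocK26Emery_Udd) (eUp := ccocK26Emery_Upp) (-10) (by simp [emeryBoxCCOCK26, emeryBoxCCOCK26Src, Function.update]) (by simp [emeryBoxCCOCK26, emeryBoxCCOCK26Src, Function.update]) (Function.update_self _ _ _) (by simp [emeryBoxCCOCK26, emeryBoxCCOCK26Src, Function.update]) (by simp [emeryBoxCCOCK26, emeryBoxCCOCK26Src, Function.update]) cuprateSigns hβ p hp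
  simp only [ccocK26Emery_Delta, ccocK26Emery_Udd, ccocK26Emery_Upp, Entry.encl_ofEnds_snd] at h
  push_cast at h
  norm_num at h ⊢
  exact h

/-! ## §2 The best floor and the HIGH-TEMPERATURE-CLOSING window -/

/-- **BEST `T > 0` FLOOR = max(atomic, family)** on the whole box at εp = -10, every β ≥ 0: the atomic floor (full entropy, slope 36.6040) wins for
β < β* ≈ 1.328 (T > 8740 K), the family floor `emeryBoxCCOCK26_pressureFloorFam_m10` (slope 37.1444, entropy ¼·log 2) for β > β*. [cite: Ruelle1969, §2.5–2.6] [cite: Israel1979, Lemma II.3.1] -/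
theorem emeryBoxCCOCK26_pressureFloorBest_m10 {β : ℝ} (hβ : 0 ≤ β) :
    HoldsOn (fun p : EmeryCoord → ℝ => max (Real.log (atomicPartitionFnReal β (154/25 : ℝ) (331/50 : ℝ)) + 2 * Real.log (atomicPartitionFnReal β (2619/500 : ℝ) (10 : ℝ))) (Real.log (Real.exp (-(β * (-146878157/1000000 : ℝ))) + Real.exp (-(β * (-148577713/1000000 : ℝ)))) / 4) ≤ emeryCellPressure β (emeryLine cuprateSigns (emeryLineCoords (((-10 : ℚ)) : ℝ) p))) emeryBoxCCOCK26 :=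
  fun p hp => max_le (emeryBoxCCOCK26_pressureAtomicFloor_m10 hβ p hp) (emeryBoxCCOCK26_pressureFloorFam_m10 hβ p hp)

/-- **THE HIGH-TEMPERATURE-CLOSING TWO-SIDED `T > 0` WINDOW** (hypothesis-free on both sides) on the whole `emeryBoxCCOCK26`, level εp = -10, EVERY β ≥ 0:
`max(atomic, family) ≤ P_cell ≤ 6 log 2 + β·836777/20000` (cap = `emeryBoxCCOCK26_pressureCap_m10_retilt`, hubbard-box-p1 re-tilted). BOTH SIDES EQUAL `6 log 2` AT β = 0; the width is `O(β)` for small β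
(slope gap 5.2348 against the atomic floor, 4.6944 against the family floor). Table [float; `T = 11604.5/β` K]:
| β (1/eV) | T (K) | atomic floor | family floor | best floor | cap | width |
|---|---|---|---|---|---|---|
| 0.01 | 1160450 | 4.3868 | 0.5426 | 4.3868 | 4.5773 | 0.1905 |
| 0.1 | 116045 | 6.6940 | 3.8674 | 6.6940 | 8.3428 | 1.6487 |
| 0.5 | 23209 | 19.6048 | 18.6612 | 19.6048 | 25.0783 | 5.4735 |
| 1 | 11604 | 37.4548 | 37.1864 | 37.4548 | 45.9977 | 8.5430 |
| 2 | 5802 | 73.7944 | 74.2971 | 74.2971 | 87.8366 | 13.5395 |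
| 5 | 2321 | 183.2028 | 185.7222 | 185.7222 | 213.3531 | 27.6309 |
| 10 | 1160 | 366.0599 | 371.4443 | 371.4443 | 422.5474 | 51.1031 |
| 20 | 580 | 732.0802 | 742.8886 | 742.8886 | 840.9359 | 98.0473 |
| 40 | 290 | 1464.1600 | 1485.7771 | 1485.7771 | 1677.7129 | 191.9358 |
[cite: Israel1979, Thm. I.2.4] [cite: Ruelle1969, §2.5–2.6] [cite: Ueltschi1999, §3] -/
theorem emeryBoxCCOCK26_pressureWindowHighT_m10 {β : ℝ} (hβ : 0 ≤ β) :
    HoldsOn (fun p : EmeryCoord → ℝ =>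
      max (Real.log (atomicPartitionFnReal β (154/25 : ℝ) (331/50 : ℝ)) + 2 * Real.log (atomicPartitionFnReal β (2619/500 : ℝ) (10 : ℝ))) (Real.log (Real.exp (-(β * (-146878157/1000000 : ℝ))) + Real.exp (-(β * (-148577713/1000000 : ℝ)))) / 4) ≤ emeryCellPressure β (emeryLine cuprateSigns (emeryLineCoords (((-10 : ℚ)) : ℝ) p)) ∧
      emeryCellPressure β (emeryLine cuprateSigns (emeryLineCoords (((-10 : ℚ)) : ℝ) p)) ≤ 6 * Real.log 2 + β * (836777/20000 : ℝ)) emeryBoxCCOCK26 :=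
  fun p hp => ⟨emeryBoxCCOCK26_pressureFloorBest_m10 hβ p hp, by simpa using emeryBoxCCOCK26_pressureCap_m10_retilt hβ p hp⟩

/-- **At β = 0 the window is a point**: `P_cell(0, ·) = 6 log 2` on the whole box (floor and cap coincide). [cite: Ueltschi1999, §3] -/
theorem emeryBoxCCOCK26_pressure_beta_zero_m10 :
    HoldsOn (fun p : EmeryCoord → ℝ => emeryCellPressure 0 (emeryLine cuprateSigns (emeryLineCoords (((-10 : ℚ)) : ℝ) p)) = 6 * Real.log 2) emeryBoxCCOCK26 := by
  intro p hp
  have h := emeryBoxCCOCK26_pressureWindowHighT_m10 le_rfl p hp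
  rw [atomicPartitionFnReal_beta_zero, atomicPartitionFnReal_beta_zero, show (4 : ℝ) = 2 ^ 2 by norm_num, Real.log_pow] at h
  simp only [Nat.cast_ofNat, zero_mul, add_zero] at h
  have h1 := (le_max_left _ _).trans h.1
  linarith [h.2]

end Summit.Ventures.CertifiedManyBodySolver.Downfold

end
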